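import Summits.QuantumFields.YangMills.Theorems.PencilRigidityWeakCouplingHypercubicLimitStubTraceCluster

/-!
# The card's `TraceClusterBound` verbatim (crux `WeakCouplingHypercubicLimit`, line `Sketch`)

The crux-ideate card `trace-norm-cold-pressure` typed its first lemma as
`def TraceClusterBound : Prop` (workfile `Cruxes/WeakCouplingHypercubicLimit/SketchIdeator1.lean`):
for `T ≥ 0` on `ℝᵈ` with `T Ω = Ω`, `‖Ω‖ = 1`, `‖T v‖ ≤ r‖v‖` on `Ω^⊥` (`0 ≤ r ≤ 1`), `b ≤ a`,
`N = a + b`, `X m := tr Tᵐ − 1`, `Z := tr Tᴺ`,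

  `|tr(Tᵃ A Tᵇ B)/Z − (tr(Tᴺ A)/Z)(tr(Tᴺ B)/Z)| ≤ ‖A‖ ‖B‖ (rᵇ (1 + X a) + rᵃ + 3 X N)`.

The registered skeleton stub `stub_traceCluster` proves the general-exponent form with the cruder
constant `X N + X p + X q + X p·X q`; this file proves the card's statement ITSELF (registered rider
`traceClusterBound_card`, `let`s unfolded), with the sharp constant `3 X N` obtained by keeping the
factor `1/Z²` on the cross terms.  The operator input is the public toolkit of the stub file
(`toolkit_powSubRankOne`: `Tᵐ − |Ω⟩⟨Ω| ≥ 0`, `‖Tᵐ − |Ω⟩⟨Ω|‖ ≤ rᵐ`, `tr(Tᵐ − |Ω⟩⟨Ω|) = tr Tᵐ − 1`;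
`trace_rankOne_mul_eq`; `abs_real_inner_apply_le_opNorm`) and the trace Hölder inequality
`stub_traceHolder`.  Finite-dimensional linear algebra, `[folklore]`.
-/

noncomputable section

open scoped BigOperators InnerProductSpace
open InnerProductSpace

namespace Summit.QuantumFields.YangMills.Theorems.WeakCouplingHypercubicLimit.TraceNormColdPressure

/-- Sharp scalar bookkeeping in the card's case `p = q = N`: the `1/Z²` factor absorbs the cross terms,
`|u/Z − (s_A/Z)(s_B/Z)| ≤ n_A n_B (r_b (1 + x_a) + r_a + 3 x_N)`. [folklore] -/
private theorem real_bookkeeping_sharp (α β e1 e2 e3 eA eB xa xN nA nB ra rb : ℝ)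
    (hnA : 0 ≤ nA) (hnB : 0 ≤ nB) (hra : 0 ≤ ra) (hrb : 0 ≤ rb) (hxa0 : 0 ≤ xa) (hxN0 : 0 ≤ xN)
    (hα : |α| ≤ nA) (hβ : |β| ≤ nB) (he1 : |e1| ≤ nA * rb * nB) (he2 : |e2| ≤ nB * ra * nA)
    (he3 : |e3| ≤ xa * (nA * rb * nB)) (heA : |eA| ≤ xN * nA) (heB : |eB| ≤ xN * nB) :
    |(α * β + e1 + e2 + e3) / (1 + xN) - (α + eA) / (1 + xN) * ((β + eB) / (1 + xN))| ≤
      nA * nB * (rb * (1 + xa) + ra + 3 * xN) := by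
  have hZ1 : (1 : ℝ) ≤ 1 + xN := by linarith
  have hZ0 : (0 : ℝ) < 1 + xN := by linarith
  have hZne : (1 + xN : ℝ) ≠ 0 := hZ0.ne'
  have key : (α * β + e1 + e2 + e3) / (1 + xN) - (α + eA) / (1 + xN) * ((β + eB) / (1 + xN)) =
      (xN * (α * β) + (1 + xN) * (e1 + e2 + e3) - α * eB - β * eA - eA * eB) / (1 + xN) ^ 2 := by
    field_simp
    ring
  rw [key, abs_div, abs_of_pos (by positivity : (0 : ℝ) < (1 + xN) ^ 2), div_le_iff₀ (by positivity)]
  have hαβ : |α| * |β| ≤ nA * nB := mul_le_mul hα hβ (abs_nonneg _) hnA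
  have h1 : |xN * (α * β)| ≤ xN * (nA * nB) := by
    rw [abs_mul, abs_of_nonneg hxN0, abs_mul]
    exact mul_le_mul_of_nonneg_left hαβ hxN0
  have h2 : |(1 + xN) * (e1 + e2 + e3)| ≤
      (1 + xN) * (nA * rb * nB + nB * ra * nA + xa * (nA * rb * nB)) := by
    rw [abs_mul, abs_of_pos hZ0]
    refine mul_le_mul_of_nonneg_left ?_ hZ0.le
    exact ((abs_add_le _ _).trans (add_le_add (abs_add_le _ _) le_rfl)).trans
      (add_le_add (add_le_add he1 he2) he3)
  have h3 : |α * eB| ≤ nA * (xN * nB) := by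
    rw [abs_mul]; exact mul_le_mul hα heB (abs_nonneg _) hnA
  have h4 : |β * eA| ≤ nB * (xN * nA) := by
    rw [abs_mul]; exact mul_le_mul hβ heA (abs_nonneg _) hnB
  have h5 : |eA * eB| ≤ xN * nA * (xN * nB) := by
    rw [abs_mul]; exact mul_le_mul heA heB (abs_nonneg _) (by positivity)
  have hnum : |xN * (α * β) + (1 + xN) * (e1 + e2 + e3) - α * eB - β * eA - eA * eB| ≤
      xN * (nA * nB) + (1 + xN) * (nA * rb * nB + nB * ra * nA + xa * (nA * rb * nB)) +
        nA * (xN * nB) + nB * (xN * nA) + xN * nA * (xN * nB) := by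
    calc |xN * (α * β) + (1 + xN) * (e1 + e2 + e3) - α * eB - β * eA - eA * eB|
        ≤ |xN * (α * β) + (1 + xN) * (e1 + e2 + e3) - α * eB - β * eA| + |eA * eB| :=
          abs_sub _ _
      _ ≤ |xN * (α * β) + (1 + xN) * (e1 + e2 + e3) - α * eB| + |β * eA| + |eA * eB| := by
          gcongr; exact abs_sub _ _
      _ ≤ |xN * (α * β) + (1 + xN) * (e1 + e2 + e3)| + |α * eB| + |β * eA| + |eA * eB| := by
          gcongr; exact abs_sub _ _
      _ ≤ |xN * (α * β)| + |(1 + xN) * (e1 + e2 + e3)| + |α * eB| + |β * eA| + |eA * eB| := by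
          gcongr; exact abs_add_le _ _
      _ ≤ _ := by linarith [h1, h2, h3, h4, h5]
  have hW2 : 0 ≤ nA * rb * nB + nB * ra * nA + xa * (nA * rb * nB) := by positivity
  have hab : 0 ≤ nA * nB := mul_nonneg hnA hnB
  have hZ2 : (1 + xN : ℝ) ≤ (1 + xN) ^ 2 := by
    calc (1 + xN : ℝ) = (1 + xN) * 1 := (mul_one _).symm
      _ ≤ (1 + xN) * (1 + xN) := mul_le_mul_of_nonneg_left hZ1 hZ0.le
      _ = (1 + xN) ^ 2 := (sq _).symm
  -- the cross terms: `xN (3 + xN) ≤ 3 xN (1 + xN)²`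
  have hcross : xN * (nA * nB) + nA * (xN * nB) + nB * (xN * nA) + xN * nA * (xN * nB) ≤
      (1 + xN) ^ 2 * (3 * xN * (nA * nB)) := by
    have e1' : xN * (nA * nB) + nA * (xN * nB) + nB * (xN * nA) + xN * nA * (xN * nB) =
        (nA * nB) * (xN * (3 + xN)) := by ring
    have e2' : (1 + xN) ^ 2 * (3 * xN * (nA * nB)) = (nA * nB) * (3 * xN * (1 + xN) ^ 2) := by ring
    rw [e1', e2']
    refine mul_le_mul_of_nonneg_left ?_ hab
    have : 0 ≤ xN * (5 * xN + 3 * xN ^ 2) := by positivity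
    nlinarith [this]
  calc |xN * (α * β) + (1 + xN) * (e1 + e2 + e3) - α * eB - β * eA - eA * eB|
      ≤ xN * (nA * nB) + (1 + xN) * (nA * rb * nB + nB * ra * nA + xa * (nA * rb * nB)) +
        nA * (xN * nB) + nB * (xN * nA) + xN * nA * (xN * nB) := hnum
    _ = (xN * (nA * nB) + nA * (xN * nB) + nB * (xN * nA) + xN * nA * (xN * nB)) +
        (1 + xN) * (nA * rb * nB + nB * ra * nA + xa * (nA * rb * nB)) := by ring
    _ ≤ (1 + xN) ^ 2 * (3 * xN * (nA * nB)) +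
        (1 + xN) ^ 2 * (nA * rb * nB + nB * ra * nA + xa * (nA * rb * nB)) :=
        add_le_add hcross (mul_le_mul_of_nonneg_right hZ2 hW2)
    _ = nA * nB * (rb * (1 + xa) + ra + 3 * xN) * (1 + xN) ^ 2 := by ring

/-- **The card's `TraceClusterBound` verbatim** (registered rider `traceClusterBound_card`; the
crux-ideate card `trace-norm-cold-pressure`, its `def TraceClusterBound : Prop` with the `let`s
unfolded): `T ≥ 0` on `ℝᵈ` with `T Ω = Ω`, `‖Ω‖ = 1`, `‖T v‖ ≤ r‖v‖` on `Ω^⊥` (`0 ≤ r ≤ 1`), `b ≤ a`,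
`N = a + b`, `X m := tr Tᵐ − 1`, `Z := tr Tᴺ`:
`|tr(Tᵃ A Tᵇ B)/Z − (tr(Tᴺ A)/Z)(tr(Tᴺ B)/Z)| ≤ ‖A‖ ‖B‖ (rᵇ (1 + X a) + rᵃ + 3 X N)`.
Same decomposition as `stub_traceCluster` (`Tᵐ = |Ω⟩⟨Ω| + R_m`, four terms, trace Hölder,
Cauchy–Schwarz); the hypotheses `r ≤ 1` and `b ≤ a` are not needed and only match the card's typing. [folklore] -/
theorem traceClusterBound_card :
    ∀ (d : ℕ) (T A B : EuclideanSpace ℝ (Fin d) →L[ℝ] EuclideanSpace ℝ (Fin d)) (Ω : EuclideanSpace ℝ (Fin d)) (r : ℝ) (a b : ℕ), T.IsPositive → ‖Ω‖ = 1 → T Ω = Ω → 0 ≤ r → r ≤ 1 → (∀ v : EuclideanSpace ℝ (Fin d), inner ℝ Ω v = 0 → ‖T v‖ ≤ r * ‖v‖) → b ≤ a → |LinearMap.trace ℝ _ (↑(T ^ a * A * T ^ b * B) : EuclideanSpace ℝ (Fin d) →ₗ[ℝ] EuclideanSpace ℝ (Fin d)) / LinearMap.trace ℝ _ (↑(T ^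 (a + b)) : EuclideanSpace ℝ (Fin d) →ₗ[ℝ] EuclideanSpace ℝ (Fin d)) - (LinearMap.trace ℝ _ (↑(T ^ (a + b) * A) : EuclideanSpace ℝ (Fin d) →ₗ[ℝ] EuclideanSpace ℝ (Fin d)) / LinearMap.trace ℝ _ (↑(T ^ (a + b)) : EuclideanSpace ℝ (Fin d) →ₗ[ℝ] EuclideanSpace ℝ (Fin d))) * (LinearMap.trace ℝ _ (↑(T ^ (a + b) * B) : EuclideanSpace ℝ (Fin d) →ₗ[ℝ] EuclideanSpace ℝ (Fin d)) / LinearMap.trace ℝ _ (↑(T ^ (a + b)) : EuclideanSpace ℝ (Fin d) →ₗ[ℝ] EuclideanSpace ℝ (Fin d)))| ≤ ‖A‖ * ‖B‖ * (r ^ b * (1 + (LinearMap.trace ℝ _ (↑(T ^ a) : EuclideanSpace ℝ (Fin d) →ₗ[ℝ] EuclideanSpace ℝ (Fin d)) - 1)) + r ^ a + 3 * (LinearMap.trace ℝ _ (↑(T ^ (a + b)) : EuclideanSpace ℝ (Fin d) →ₗ[ℝ] EuclideanSpace ℝ (Fin d)) - 1)) := by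
  intro d T A B Ω r a b hT hΩ hTΩ hr0 _hr1 hcon _hba
  -- notation: `P = |Ω⟩⟨Ω|`, `τ = tr`
  set P : EuclideanSpace ℝ (Fin d) →L[ℝ] EuclideanSpace ℝ (Fin d) := rankOne ℝ Ω Ω with hPdef
  have hdec : ∀ m : ℕ, T ^ m = P + (T ^ m - P) := fun m => by abel
  set τ : (EuclideanSpace ℝ (Fin d) →L[ℝ] EuclideanSpace ℝ (Fin d)) → ℝ :=
    fun M => LinearMap.trace ℝ _ (↑M : EuclideanSpace ℝ (Fin d) →ₗ[ℝ] EuclideanSpace ℝ (Fin d)) with hτ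
  have τ_add : ∀ M M', τ (M + M') = τ M + τ M' := fun M M' => by
    simp only [hτ, ContinuousLinearMap.toLinearMap_add, map_add]
  have τ_comm : ∀ M M' : EuclideanSpace ℝ (Fin d) →L[ℝ] EuclideanSpace ℝ (Fin d),
      τ (M * M') = τ (M' * M) := fun M M' => by
    simp only [hτ]
    rw [ContinuousLinearMap.toLinearMap_mul, LinearMap.trace_mul_comm,
      ← ContinuousLinearMap.toLinearMap_mul]
  have τ_P_mul : ∀ M : EuclideanSpace ℝ (Fin d) →L[ℝ] EuclideanSpace ℝ (Fin d),
      τ (P * M) = inner ℝ Ω (M Ω) := fun M => trace_rankOne_mul_eq M Ω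
  -- the toolkit: positivity, contraction and trace excess of `Tᵐ − P`
  have htk := fun m : ℕ => toolkit_powSubRankOne d T Ω r m hT hΩ hTΩ hr0 hcon
  have hRpos : ∀ m : ℕ, (T ^ m - P).IsPositive := fun m => (htk m).1
  have hRn : ∀ m : ℕ, ‖T ^ m - P‖ ≤ r ^ m := fun m => (htk m).2.1
  have hx : ∀ m : ℕ, τ (T ^ m - P) = τ (T ^ m) - 1 := fun m => (htk m).2.2
  have hx0 : ∀ m : ℕ, 0 ≤ τ (T ^ m - P) := fun m => (hRpos m).toLinearMap.trace_nonneg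
  -- the pieces
  have hα : |inner ℝ Ω (A Ω)| ≤ ‖A‖ := abs_real_inner_apply_le_opNorm A hΩ
  have hβ : |inner ℝ Ω (B Ω)| ≤ ‖B‖ := abs_real_inner_apply_le_opNorm B hΩ
  have hARB : ‖A * (T ^ b - P) * B‖ ≤ ‖A‖ * r ^ b * ‖B‖ := by
    calc ‖A * (T ^ b - P) * B‖ ≤ ‖A * (T ^ b - P)‖ * ‖B‖ := norm_mul_le _ _
      _ ≤ ‖A‖ * ‖T ^ b - P‖ * ‖B‖ := by gcongr; exact norm_mul_le _ _
      _ ≤ ‖A‖ * r ^ b * ‖B‖ := by gcongr; exact hRn b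
  have hBRA : ‖B * (T ^ a - P) * A‖ ≤ ‖B‖ * r ^ a * ‖A‖ := by
    calc ‖B * (T ^ a - P) * A‖ ≤ ‖B * (T ^ a - P)‖ * ‖A‖ := norm_mul_le _ _
      _ ≤ ‖B‖ * ‖T ^ a - P‖ * ‖A‖ := by gcongr; exact norm_mul_le _ _
      _ ≤ ‖B‖ * r ^ a * ‖A‖ := by gcongr; exact hRn a
  have he1 : |inner ℝ Ω ((A * (T ^ b - P) * B) Ω)| ≤ ‖A‖ * r ^ b * ‖B‖ :=
    (abs_real_inner_apply_le_opNorm _ hΩ).trans hARB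
  have he2 : |inner ℝ Ω ((B * (T ^ a - P) * A) Ω)| ≤ ‖B‖ * r ^ a * ‖A‖ :=
    (abs_real_inner_apply_le_opNorm _ hΩ).trans hBRA
  have he3 : |τ ((T ^ a - P) * (A * (T ^ b - P) * B))| ≤ τ (T ^ a - P) * (‖A‖ * r ^ b * ‖B‖) :=
    (stub_traceHolder d _ _ (hRpos a)).trans (mul_le_mul_of_nonneg_left hARB (hx0 a))
  have heA : |τ ((T ^ (a + b) - P) * A)| ≤ τ (T ^ (a + b) - P) * ‖A‖ :=
    stub_traceHolder d _ _ (hRpos (a + b))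
  have heB : |τ ((T ^ (a + b) - P) * B)| ≤ τ (T ^ (a + b) - P) * ‖B‖ :=
    stub_traceHolder d _ _ (hRpos (a + b))
  -- the identities
  have hu : τ (T ^ a * A * T ^ b * B) = inner ℝ Ω (A Ω) * inner ℝ Ω (B Ω) +
      inner ℝ Ω ((A * (T ^ b - P) * B) Ω) + inner ℝ Ω ((B * (T ^ a - P) * A) Ω) +
      τ ((T ^ a - P) * (A * (T ^ b - P) * B)) := by
    have e : T ^ a * A * T ^ b * B = P * (A * P * B) + P * (A * (T ^ b - P) * B) +
        (T ^ a - P) * A * (P * B) + (T ^ a - P) * (A * (T ^ b - P) * B) := by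
      conv_lhs => rw [hdec a, hdec b]
      noncomm_ring
    have hPAPB : τ (P * (A * P * B)) = inner ℝ Ω (A Ω) * inner ℝ Ω (B Ω) := by
      rw [τ_P_mul, mul_apply_eq_comp, mul_apply_eq_comp]
      simp only [hPdef, rankOne_apply, map_smul, real_inner_smul_right]
      ring
    rw [e, τ_add, τ_add, τ_add, hPAPB, τ_P_mul, τ_comm ((T ^ a - P) * A) (P * B),
      mul_assoc P B, τ_P_mul, ← mul_assoc]
  have hsA : τ (T ^ (a + b) * A) = inner ℝ Ω (A Ω) + τ ((T ^ (a + b) - P) * A) := by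
    conv_lhs => rw [hdec (a + b)]
    rw [add_mul, τ_add, τ_P_mul]
  have hsB : τ (T ^ (a + b) * B) = inner ℝ Ω (B Ω) + τ ((T ^ (a + b) - P) * B) := by
    conv_lhs => rw [hdec (a + b)]
    rw [add_mul, τ_add, τ_P_mul]
  have hZ : τ (T ^ (a + b)) = 1 + τ (T ^ (a + b) - P) := by rw [hx (a + b)]; ring
  -- assemble
  change |τ (T ^ a * A * T ^ b * B) / τ (T ^ (a + b)) -
      τ (T ^ (a + b) * A) / τ (T ^ (a + b)) * (τ (T ^ (a + b) * B) / τ (T ^ (a + b)))|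
    ≤ ‖A‖ * ‖B‖ * (r ^ b * (1 + (τ (T ^ a) - 1)) + r ^ a + 3 * (τ (T ^ (a + b)) - 1))
  rw [hu, hsA, hsB, ← hx a, hZ, add_sub_cancel_left]
  exact real_bookkeeping_sharp _ _ _ _ _ _ _ _ _ ‖A‖ ‖B‖ (r ^ a) (r ^ b)
    (norm_nonneg _) (norm_nonneg _) (pow_nonneg hr0 _) (pow_nonneg hr0 _) (hx0 a) (hx0 (a + b))
    hα hβ he1 he2 he3 heA heB

end Summit.QuantumFields.YangMills.Theorems.WeakCouplingHypercubicLimit.TraceNormColdPressure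

end
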